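/-
Copyright (c) 2026. All rights reserved.
Released under Apache 2.0 license as described in the file LICENSE.
Authors: HodgeCM publication cell (pub-hodgecm), model-construction sub-cell, construction prover `mc-axioms-2`.
-/
import Mathlib.Algebra.Module.LinearMap.Defs
import Literature.GroupTheory.CocycleCentralExtension
import HarnessLib

/-!
# Splittings forced by an invariant functional (Weil's `r_k`, the theta-forced multiplier)

Topic `GroupTheory`; namespace `Literature.GroupTheory.TwistedProduct` (continuing
`CocycleCentralExtension.lean`).  KERNEL MATHEMATICS ONLY: no `def … : Prop` records of published theorems,
no `axiom`, no proof holes; every tag below is provenance for a kernel-checked statement.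

SETTING (that file's §5 operator model): a map `r : G → M` into a GROUP of operators with multiplier the
central 2-cocycle `c` relative to scalars `z : A →* M` (`r g₁ * r g₂ = z (c g₁ g₂) * r (g₁ g₂)`,
`HasMultiplier c z r`), the scalars commuting with the `r g`; `M` acts on a set `S` (`MulAction M S`) and
`Θ : S → X` is any function ("functional") which DETECTS SCALARS:
`∀ a, (∀ Φ, Θ (z a • Φ) = Θ Φ) → a = 1` — e.g. a non-zero linear functional and `z a • Φ = a • Φ`.

WHAT IS HERE (all proved):

* `fixer Θ : Subgroup M` — the operators `T` with `Θ (T • Φ) = Θ Φ` for all `Φ`;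
* `scalar_eq_of_mem_fixer` — over a fixed `g`, AT MOST ONE scalar correction `z a * r g` fixes `Θ`;
* `isSplitting_of_mem_fixer` — **if for every `h : H` the corrected operator `z (β h) * r (ι h)` fixes `Θ`,
  then `β` SPLITS `c` over `ι : H →* G`** (`IsSplitting c ι β`: `β (h h′) = β h * β h′ * c (ι h) (ι h′)`),
  i.e. `h ↦ (ι h, β h)` is a homomorphism `H →* G ×_c A` (`IsSplitting.lift`) — the cocycle restricted to
  `ι(H)` is the coboundary of `β⁻¹`, with no computation of `c`;
* `exists_mem_fixer_of_mem_closure` — the set of `g` admitting a `Θ`-fixing correction is closed under the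
  group operations: if each GENERATOR `t ∈ T` admits one, so does every `g ∈ Subgroup.closure T`;
* `exists_isSplitting_of_closure` / `existsUnique_isSplitting_of_closure` — hence over any subgroup
  `Γ ≤ closure T` there is a UNIQUE `Θ`-fixing splitting function `β : Γ → A`, and
  `opHom ∘ lift(β)` takes values in `fixer Θ` (`opHom_lift_mem_fixer`);
* `forcedCorr z r Θ g` (the canonical correction `β_Θ`), `isSplitting_forcedCorr`, **`ratLift … Γ hΓ : Γ →* G ×_c A`**
  (`γ ↦ (γ, β_Θ γ)`, Weil's `r_k`), `opHom_ratLift_mem_fixer` (its operators fix `Θ`), `eq_ratLift` (unique such lift);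
* `eq_of_mem_fixer` — two `Θ`-fixing corrections over the same `ι` coincide (so a second splitting `β′`
  over `ι`, e.g. an adelic one, fixes `Θ` iff `β′ = β`, `mem_fixer_iff_eq`).

WHY (the use in the model construction, informal; nothing below is asserted in this file): with `G = Sp(𝕎)(𝔸_F)`
acting through the adelic Schrödinger-model operators `r` (multiplier = the adelic Rao cocycle), `S = 𝒮(𝔸_Fⁿ)`,
`Θ` the theta distribution `Φ ↦ Σ_{ξ ∈ Fⁿ} Φ(ξ)` (tree: `Weil1964.AdelicThetaDistribution`, which detects
scalars since `Θ ≠ 0` is linear) and `T` = the rational points of the Siegel parabolic together with the Weyl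
element (whose operators — rational twists, rational second-degree characters, the self-dual Fourier
transform — fix `Θ`: tree `Literature.NumberTheory.Weil1964.twistUnit_ratGL_mem_thetaStabilizer`,
`chirpUnit_ratMatrix_mem_thetaStabilizer`, `closure_ratGL_ratMatrix_le_thetaStabilizer` (group level) and
`thetaDistLM_fourierLM_of_measure_eq_one` / `fourierLM_mem_thetaStabilizerEnd` (linear-map level); `Θ ≠ 0`:
`thetaDistLM_ne_zero`), the theorems here produce the homomorphic lift of
`Γ = Sp(𝕎)(F) ≤ closure T` into `Sp(𝕎)(𝔸) ×_c A` under which theta series are automorphic — A. Weil's `r_k`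
[Weil1964, Chap. III n° 40 p. 190: "on peut donc … définir ici un relèvement de `Ps(X)_k` dans `B₀(G)`, et par
suite un relèvement de `Ps(X)_k` dans `Mp(X)_A`, qu'on notera `r_k`"; Thm 6 n° 41 p. 193] — in the coordinates
of [KudlaRapoportYang2006, Lemma 8.5.15 (iii)] ("a unique splitting homomorphism `s : G(ℚ) → G̃_𝔸`,
`s(g) = [g, λ(g)⁻¹]`"): the rational cocycle need not be trivial, only the coboundary of the `Θ`-forced `β`.
So the product formula for the cocycle on rational points is not an input of that construction; what remains
an input about a SECOND (adelic, place-by-place) splitting `β′` of a member of a dual pair is exactly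
`β′|_Γ = β` (`mem_fixer_iff_eq`), cf. [HarrisKudlaSweet1996, §1 (1.16)–(1.17) p. 952].

## References

* [Weil1964] A. Weil, *Sur certains groupes d'opérateurs unitaires*, Acta Math. 111 (1964) 143–211,
  Chap. III n° 40 p. 190, n° 41 Thm 6 p. 193.
* [KudlaRapoportYang2006] S. Kudla, M. Rapoport, T. Yang, *Modular forms and special cycles on Shimura
  curves*, Annals of Math. Studies 161 (2006), Ch. 8 appendix, Lemma 8.5.15.
* [HarrisKudlaSweet1996] M. Harris, S. Kudla, W. Sweet, *Theta dichotomy for unitary groups*, J. Amer.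
  Math. Soc. 9 (1996) 941–1004, §1 (1.14)–(1.17).
-/

set_option autoImplicit false

namespace Literature.GroupTheory

namespace TwistedProduct

universe u v w

variable {G : Type u} {A : Type v} [Group G] [CommGroup A] {c : CentralCocycle G A}
variable {M : Type*} [Group M] {S : Type*} [MulAction M S] {X : Type*}

/-! ## 1. The fixer of a functional -/

/-- The operators fixing the functional `Θ`: `T ∈ fixer Θ ↔ ∀ Φ, Θ (T • Φ) = Θ Φ` — a subgroup
(the inverse of a `Θ`-fixing bijection fixes `Θ`). [folklore] -/
def fixer (Θ : S → X) : Subgroup M where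
  carrier := {T | ∀ Φ : S, Θ (T • Φ) = Θ Φ}
  one_mem' := fun Φ => by rw [one_smul]
  mul_mem' := fun {T U} hT hU Φ => by rw [mul_smul, hT, hU]
  inv_mem' := fun {T} hT Φ => by rw [← hT (T⁻¹ • Φ), smul_inv_smul]

/-- `T ∈ fixer Θ ↔ ∀ Φ, Θ (T • Φ) = Θ Φ`. [folklore] -/
@[simp] theorem mem_fixer_iff (Θ : S → X) (T : M) : T ∈ fixer Θ ↔ ∀ Φ : S, Θ (T • Φ) = Θ Φ := Iff.rfl

variable {z : A →* M} {r : G → M} {Θ : S → X}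

/-- `Θ` DETECTS SCALARS: the only scalar fixing `Θ` is `1`.  For a non-zero additive `Θ` and the scalar
action `z a • Φ = a • Φ` on a vector space this holds (`Θ (a • Φ) = a • Θ Φ`, pick `Φ` with `Θ Φ ≠ 0`).
A definition (hypothesis shape), nothing asserted. [folklore] -/
def DetectsScalars (z : A →* M) (Θ : S → X) : Prop :=
  ∀ a : A, z a ∈ fixer Θ → a = 1

omit [Group G] in
/-- UNIQUENESS OF THE CORRECTION: if `z a * r g` and `z b * r g` both fix `Θ`, then `a = b`. [folklore] -/
theorem scalar_eq_of_mem_fixer (hΘ : DetectsScalars z Θ) {a b : A} {g : G}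
    (ha : z a * r g ∈ fixer Θ) (hb : z b * r g ∈ fixer Θ) : a = b := by
  have hab : z (a / b) ∈ fixer Θ := by
    have h := (fixer Θ).mul_mem ha ((fixer Θ).inv_mem hb)
    rwa [mul_inv_rev, ← mul_assoc, mul_assoc (z a), mul_inv_cancel, mul_one, ← map_inv,
      ← map_mul, ← div_eq_mul_inv] at h
  exact div_eq_one.mp (hΘ _ hab)

/-- the corrected operators multiply like the twisted product:
`(z a * r g) * (z b * r g') = z (a * b * c g g') * r (g * g')`. [folklore] -/
theorem corr_mul_corr (hr : HasMultiplier c z r) (hz : ∀ (a : A) (g : G), Commute (z a) (r g))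
    (a b : A) (g g' : G) :
    (z a * r g) * (z b * r g') = z (a * b * c g g') * r (g * g') := by
  calc z a * r g * (z b * r g')
      = z a * (r g * z b) * r g' := by simp only [mul_assoc]
    _ = z a * (z b * r g) * r g' := by rw [(hz b g).eq]
    _ = z a * z b * (r g * r g') := by simp only [mul_assoc]
    _ = z a * z b * (z (c g g') * r (g * g')) := by rw [hr]
    _ = z (a * b * c g g') * r (g * g') := by simp only [map_mul, mul_assoc]

/-- the inverse of a corrected operator is a corrected operator over `g⁻¹`:
`(z a * r g)⁻¹ = z ((c g⁻¹ g)⁻¹ * a⁻¹) * r g⁻¹` (uses `r 1 = 1`). [folklore] -/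
theorem corr_inv (hr : HasMultiplier c z r) (h1 : r 1 = 1) (hz : ∀ (a : A) (g : G), Commute (z a) (r g))
    (a : A) (g : G) :
    (z a * r g)⁻¹ = z ((c g⁻¹ g)⁻¹ * a⁻¹) * r g⁻¹ := by
  have hinv : r g⁻¹ * r g = z (c g⁻¹ g) := by rw [hr, inv_mul_cancel, h1, mul_one]
  have hrg : (r g)⁻¹ = (z (c g⁻¹ g))⁻¹ * r g⁻¹ := by
    rw [eq_inv_mul_iff_mul_eq, ← hinv, mul_inv_cancel_right]
  calc (z a * r g)⁻¹ = (r g)⁻¹ * (z a)⁻¹ := mul_inv_rev _ _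
    _ = (z (c g⁻¹ g))⁻¹ * r g⁻¹ * (z a)⁻¹ := by rw [hrg]
    _ = (z (c g⁻¹ g))⁻¹ * (r g⁻¹ * z a⁻¹) := by rw [← map_inv z a, mul_assoc]
    _ = (z (c g⁻¹ g))⁻¹ * (z a⁻¹ * r g⁻¹) := by rw [← (hz a⁻¹ g⁻¹).eq]
    _ = z ((c g⁻¹ g)⁻¹ * a⁻¹) * r g⁻¹ := by rw [← mul_assoc, ← map_inv z, ← map_mul z]

/-! ## 2. A `Θ`-fixing correction is a splitting -/

section Splitting

variable {H : Type w} [Group H] {ι : H →* G} {β β' : H → A}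

/-- **THE `Θ`-FORCED MULTIPLIER SPLITS THE COCYCLE.**  If every corrected operator `z (β h) * r (ι h)`
(`h : H`) fixes a scalar-detecting functional `Θ`, then `β (h h′) = β h * β h′ * c (ι h) (ι h′)`: `β` is a
splitting function of `c` over `ι` (so `h ↦ (ι h, β h)` is a homomorphism `H →* G ×_c A`, `IsSplitting.lift`).
Proof: both `z (β (hh′)) * r (ι h ι h′)` and the product `(z (β h) r (ι h)) (z (β h′) r (ι h′)) =
z (β h β h′ c) * r (ι h ι h′)` fix `Θ`; uniqueness of the correction.  This is the mechanism of Weil's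
rational lift `r_k` [Weil1964, Chap. III n° 40–41] in the coordinates of [KudlaRapoportYang2006,
Lemma 8.5.15 (iii)]. [folklore] -/
theorem isSplitting_of_mem_fixer (hr : HasMultiplier c z r) (hz : ∀ (a : A) (g : G), Commute (z a) (r g))
    (hΘ : DetectsScalars z Θ) (hβ : ∀ h : H, z (β h) * r (ι h) ∈ fixer Θ) : IsSplitting c ι β := by
  intro h h'
  have hprod : z (β h * β h' * c (ι h) (ι h')) * r (ι (h * h')) ∈ fixer Θ := by
    rw [map_mul ι, ← corr_mul_corr hr hz]
    exact (fixer Θ).mul_mem (hβ h) (hβ h')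
  exact scalar_eq_of_mem_fixer hΘ (hβ (h * h')) hprod

/-- TWO `Θ`-FIXING CORRECTIONS OVER THE SAME `ι` COINCIDE. [folklore] -/
theorem eq_of_mem_fixer (hΘ : DetectsScalars z Θ) (hβ : ∀ h : H, z (β h) * r (ι h) ∈ fixer Θ)
    (hβ' : ∀ h : H, z (β' h) * r (ι h) ∈ fixer Θ) : β = β' :=
  funext fun h => scalar_eq_of_mem_fixer hΘ (hβ h) (hβ' h)

/-- hence a second family of corrections `β′` over `ι` (e.g. another splitting) fixes `Θ` iff it equals the
`Θ`-fixing one. [folklore] -/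
theorem mem_fixer_iff_eq (hΘ : DetectsScalars z Θ) (hβ : ∀ h : H, z (β h) * r (ι h) ∈ fixer Θ) :
    (∀ h : H, z (β' h) * r (ι h) ∈ fixer Θ) ↔ β' = β :=
  ⟨fun hβ' => (eq_of_mem_fixer hΘ hβ hβ').symm, fun e => e ▸ hβ⟩

/-- in the operator model, "the corrected operators fix `Θ`" says: the homomorphism `opHom ∘ lift(β) : H →* M`
takes values in `fixer Θ` (automorphy of `h ↦ Θ (ω(ι̃ h) • Φ)`). [folklore] -/
theorem opHom_lift_mem_fixer (hr : HasMultiplier c z r) (h1 : r 1 = 1)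
    (hz : ∀ (a : A) (g : G), Commute (z a) (r g)) (hs : IsSplitting c ι β)
    (hβ : ∀ h : H, z (β h) * r (ι h) ∈ fixer Θ) (h : H) :
    (opHom hr h1 hz).comp hs.lift h ∈ fixer Θ := by
  rw [opHom_comp_lift_apply]
  exact hβ h

end Splitting

/-! ## 3. Existence over the subgroup generated by `Θ`-fixable generators -/

/-- **GENERATION.**  If every generator `t ∈ T` admits a scalar correction `z a * r t` fixing `Θ`, then so
does every element of `Subgroup.closure T` (products: `corr_mul_corr`; inverses: `corr_inv`; `r 1 = 1`).
[folklore] -/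
theorem exists_mem_fixer_of_mem_closure (hr : HasMultiplier c z r) (h1 : r 1 = 1)
    (hz : ∀ (a : A) (g : G), Commute (z a) (r g)) {T : Set G}
    (hT : ∀ t ∈ T, ∃ a : A, z a * r t ∈ fixer Θ) {g : G} (hg : g ∈ Subgroup.closure T) :
    ∃ a : A, z a * r g ∈ fixer Θ := by
  induction hg using Subgroup.closure_induction with
  | mem t ht => exact hT t ht
  | one => exact ⟨1, by rw [map_one, h1, mul_one]; exact (fixer Θ).one_mem⟩
  | mul x y _ _ hx hy =>
    obtain ⟨a, ha⟩ := hx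
    obtain ⟨b, hb⟩ := hy
    exact ⟨a * b * c x y, by rw [← corr_mul_corr hr hz]; exact (fixer Θ).mul_mem ha hb⟩
  | inv x _ hx =>
    obtain ⟨a, ha⟩ := hx
    exact ⟨(c x⁻¹ x)⁻¹ * a⁻¹, by rw [← corr_inv hr h1 hz]; exact (fixer Θ).inv_mem ha⟩

/-- **EXISTENCE OF THE `Θ`-FORCED SPLITTING over a subgroup `Γ` generated by `Θ`-fixable elements**: there is
a splitting function `β : Γ → A` of `c` over the inclusion `Γ.subtype` all of whose corrected operators fix `Θ`
(Weil's `r_k` on `Γ = Sp(X)_k` [Weil1964, Chap. III n° 40]; `s(g) = [g, λ(g)⁻¹]` of [KudlaRapoportYang2006,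
Lemma 8.5.15 (iii)]). [folklore] -/
theorem exists_isSplitting_of_closure (hr : HasMultiplier c z r) (h1 : r 1 = 1)
    (hz : ∀ (a : A) (g : G), Commute (z a) (r g)) (hΘ : DetectsScalars z Θ) {T : Set G}
    (hT : ∀ t ∈ T, ∃ a : A, z a * r t ∈ fixer Θ) (Γ : Subgroup G) (hΓ : Γ ≤ Subgroup.closure T) :
    ∃ β : Γ → A, IsSplitting c Γ.subtype β ∧ ∀ γ : Γ, z (β γ) * r γ ∈ fixer Θ := by
  choose β hβ using fun γ : Γ => exists_mem_fixer_of_mem_closure hr h1 hz hT (hΓ γ.2)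
  exact ⟨β, isSplitting_of_mem_fixer hr hz hΘ hβ, hβ⟩

/-- … and it is UNIQUE ("a unique splitting homomorphism" [KudlaRapoportYang2006, Lemma 8.5.15 (iii)]).
[folklore] -/
theorem existsUnique_isSplitting_of_closure (hr : HasMultiplier c z r) (h1 : r 1 = 1)
    (hz : ∀ (a : A) (g : G), Commute (z a) (r g)) (hΘ : DetectsScalars z Θ) {T : Set G}
    (hT : ∀ t ∈ T, ∃ a : A, z a * r t ∈ fixer Θ) (Γ : Subgroup G) (hΓ : Γ ≤ Subgroup.closure T) :
    ∃! β : Γ → A, IsSplitting c Γ.subtype β ∧ ∀ γ : Γ, z (β γ) * r γ ∈ fixer Θ := by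
  obtain ⟨β, hs, hβ⟩ := exists_isSplitting_of_closure hr h1 hz hΘ hT Γ hΓ
  exact ⟨β, ⟨hs, hβ⟩, fun β' hβ' => eq_of_mem_fixer (ι := Γ.subtype) hΘ hβ'.2 hβ⟩

/-! ## 3b. The canonical `Θ`-forced correction and the rational lift, packaged -/

open Classical in
variable (z r Θ) in
/-- **The `Θ`-forced correction** `β_Θ(g) ∈ A`: the (unique, `scalar_eq_of_mem_fixer`) scalar `a` with
`z a * r g ∈ fixer Θ` when one exists, else `1` (junk).  Depends only on `z`, `r`, `Θ`, `g` — Weil's `λ(g)⁻¹`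
[KudlaRapoportYang2006, Lemma 8.5.15 (iii)]. [folklore] -/
noncomputable def forcedCorr (g : G) : A :=
  if h : ∃ a : A, z a * r g ∈ fixer Θ then h.choose else 1

omit [Group G] in
/-- when some correction over `g` fixes `Θ`, the forced one does. [folklore] -/
theorem forcedCorr_mem_fixer {g : G} (h : ∃ a : A, z a * r g ∈ fixer Θ) :
    z (forcedCorr z r Θ g) * r g ∈ fixer Θ := by
  rw [forcedCorr, dif_pos h]
  exact h.choose_spec

omit [Group G] in
/-- … and it is the only one. [folklore] -/
theorem eq_forcedCorr_of_mem_fixer (hΘ : DetectsScalars z Θ) {g : G} {a : A} (ha : z a * r g ∈ fixer Θ) :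
    a = forcedCorr z r Θ g :=
  scalar_eq_of_mem_fixer hΘ ha (forcedCorr_mem_fixer ⟨a, ha⟩)

/-- **`β_Θ` splits `c` over any subgroup all of whose elements admit a `Θ`-fixing correction** (e.g.
`Γ ≤ closure T` with `Θ`-fixable generators, `exists_mem_fixer_of_mem_closure`). [folklore] -/
theorem isSplitting_forcedCorr (hr : HasMultiplier c z r) (hz : ∀ (a : A) (g : G), Commute (z a) (r g))
    (hΘ : DetectsScalars z Θ) (Γ : Subgroup G) (hΓ : ∀ γ ∈ Γ, ∃ a : A, z a * r γ ∈ fixer Θ) :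
    IsSplitting c Γ.subtype (fun γ : Γ => forcedCorr z r Θ (γ : G)) :=
  isSplitting_of_mem_fixer hr hz hΘ fun γ => forcedCorr_mem_fixer (hΓ γ γ.2)

/-- **THE RATIONAL LIFT `r_Θ : Γ →* G ×_c A`, `γ ↦ (γ, β_Θ γ)`** (Weil's `r_k` when `Γ = Sp(X)_k`
[Weil1964, Chap. III n° 40 p. 190]). [folklore] -/
noncomputable def ratLift (hr : HasMultiplier c z r) (hz : ∀ (a : A) (g : G), Commute (z a) (r g))
    (hΘ : DetectsScalars z Θ) (Γ : Subgroup G) (hΓ : ∀ γ ∈ Γ, ∃ a : A, z a * r γ ∈ fixer Θ) :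
    Γ →* TwistedProduct c :=
  (isSplitting_forcedCorr hr hz hΘ Γ hΓ).lift

/-- `r_Θ γ = (γ, β_Θ γ)`. [folklore] -/
@[simp] theorem ratLift_apply (hr : HasMultiplier c z r) (hz : ∀ (a : A) (g : G), Commute (z a) (r g))
    (hΘ : DetectsScalars z Θ) (Γ : Subgroup G) (hΓ : ∀ γ ∈ Γ, ∃ a : A, z a * r γ ∈ fixer Θ) (γ : Γ) :
    ratLift hr hz hΘ Γ hΓ γ = ⟨(γ : G), forcedCorr z r Θ (γ : G)⟩ := rfl

/-- `r_Θ` is a lift: `fst ∘ r_Θ = Γ.subtype`. [folklore] -/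
theorem fst_comp_ratLift (hr : HasMultiplier c z r) (hz : ∀ (a : A) (g : G), Commute (z a) (r g))
    (hΘ : DetectsScalars z Θ) (Γ : Subgroup G) (hΓ : ∀ γ ∈ Γ, ∃ a : A, z a * r γ ∈ fixer Θ) :
    (fst c).comp (ratLift hr hz hΘ Γ hΓ) = Γ.subtype := rfl

/-- **AUTOMORPHY**: the operators `ω(r_Θ γ) = z (β_Θ γ) * r γ` fix `Θ` (Weil's Thm 6 shape
`Θ(r_k(s)Φ) = Θ(Φ)` [Weil1964, n° 41 p. 193], here by construction). [folklore] -/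
theorem opHom_ratLift_mem_fixer (hr : HasMultiplier c z r) (h1 : r 1 = 1)
    (hz : ∀ (a : A) (g : G), Commute (z a) (r g)) (hΘ : DetectsScalars z Θ) (Γ : Subgroup G)
    (hΓ : ∀ γ ∈ Γ, ∃ a : A, z a * r γ ∈ fixer Θ) (γ : Γ) :
    opHom hr h1 hz (ratLift hr hz hΘ Γ hΓ γ) ∈ fixer Θ := by
  rw [ratLift_apply, opHom_apply]
  exact forcedCorr_mem_fixer (hΓ γ γ.2)

/-- UNIQUENESS OF THE RATIONAL LIFT among lifts whose operators fix `Θ`: any homomorphism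
`s : Γ →* G ×_c A` over `Γ.subtype` with `opHom ∘ s ⊆ fixer Θ` equals `r_Θ`. [folklore] -/
theorem eq_ratLift (hr : HasMultiplier c z r) (h1 : r 1 = 1)
    (hz : ∀ (a : A) (g : G), Commute (z a) (r g)) (hΘ : DetectsScalars z Θ) (Γ : Subgroup G)
    (hΓ : ∀ γ ∈ Γ, ∃ a : A, z a * r γ ∈ fixer Θ) (s : Γ →* TwistedProduct c)
    (hs : (fst c).comp s = Γ.subtype) (hfix : ∀ γ : Γ, opHom hr h1 hz (s γ) ∈ fixer Θ) :
    s = ratLift hr hz hΘ Γ hΓ := by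
  ext γ
  · simpa using DFunLike.congr_fun hs γ
  · have hg : (s γ).g = (γ : G) := by simpa using DFunLike.congr_fun hs γ
    have hγ := hfix γ
    rw [opHom_apply, hg] at hγ
    simpa using eq_forcedCorr_of_mem_fixer hΘ hγ

/-- `eq_ratLift` under the name requested by the W4-c consumer (mc-weil-2, 2026-08-18):
any homomorphic section of `fst c` over `Γ` whose operators fix `Θ` IS `ratLift`. [folklore] -/
theorem eq_ratLift_of_mem_fixer (hr : HasMultiplier c z r) (h1 : r 1 = 1)
    (hz : ∀ (a : A) (g : G), Commute (z a) (r g)) (hΘ : DetectsScalars z Θ) (Γ : Subgroup G)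
    (hΓ : ∀ γ ∈ Γ, ∃ a : A, z a * r γ ∈ fixer Θ) (s : Γ →* TwistedProduct c)
    (hs : (fst c).comp s = Γ.subtype) (hfix : ∀ γ : Γ, opHom hr h1 hz (s γ) ∈ fixer Θ) :
    s = ratLift hr hz hΘ Γ hΓ :=
  eq_ratLift hr h1 hz hΘ Γ hΓ s hs hfix

/-- The hypothesis `hΓ` of `ratLift` in the GENERATOR form in which it is supplied on the E2 path
(Weil's `r_k`, [Weil1964] n°40 p.190 with Lemme 6, n°33 p.185: `Sp(X)_k` is generated by
`P(X)_k` and one more element): if every element of a generating set `T` admits a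
`Θ`-fixing correction and `Γ ≤ Subgroup.closure T`, then every element of `Γ` does. [folklore] -/
theorem forall_exists_mem_fixer_of_le_closure (hr : HasMultiplier c z r) (h1 : r 1 = 1)
    (hz : ∀ (a : A) (g : G), Commute (z a) (r g)) {T : Set G}
    (hT : ∀ t ∈ T, ∃ a : A, z a * r t ∈ fixer Θ) {Γ : Subgroup G} (hΓ : Γ ≤ Subgroup.closure T) :
    ∀ γ ∈ Γ, ∃ a : A, z a * r γ ∈ fixer Θ :=
  fun _ hγ => exists_mem_fixer_of_mem_closure hr h1 hz hT (hΓ hγ)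

/-! ## 4. The linear case: a non-zero linear functional detects scalars -/

section Linear

variable {R : Type*} {V : Type*} [CommRing R] [NoZeroDivisors R] [AddCommGroup V] [Module R V]
  {N : Type*} [Group N] [MulAction N V]

/-- For scalars acting as scalars (`z a • Φ = (u a : Rˣ) • Φ` for an injective homomorphism `u : A →* Rˣ`)
and an `R`-linear functional `Θ ≠ 0` (`R` without zero divisors), `Θ` detects scalars:
`Θ ((u a) • Φ) = Θ Φ` for all `Φ` forces `u a = 1`, hence `a = 1`. [folklore] -/
theorem detectsScalars_of_linear {zN : A →* N} (u : A →* Rˣ) (hu : Function.Injective u)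
    (hz : ∀ (a : A) (Φ : V), zN a • Φ = (u a : R) • Φ) (Θ : V →ₗ[R] R) (hΘ : Θ ≠ 0) :
    DetectsScalars zN (Θ : V → R) := by
  intro a ha
  obtain ⟨Φ, hΦ⟩ : ∃ Φ, Θ Φ ≠ 0 := by
    by_contra h
    push Not at h
    exact hΘ (LinearMap.ext fun Φ => by simpa using h Φ)
  have h1 : ((u a : R) - 1) * Θ Φ = 0 := by
    have := ha Φ
    rw [hz, map_smul, smul_eq_mul] at this
    rw [sub_mul, one_mul, this, sub_self]
  have hua : (u a : R) = 1 := by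
    rcases mul_eq_zero.mp h1 with h | h
    · exact sub_eq_zero.mp h
    · exact absurd h hΦ
  apply hu
  rw [map_one]
  exact Units.ext hua

end Linear

end TwistedProduct

end Literature.GroupTheory
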